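import Summits.AtomisticToContinuum.HydrodynamicLimit.Theorems.InformationPercolationEngineCollisionRate
import Summits.AtomisticToContinuum.HydrodynamicLimit.Theorems.EvenStressEnskog.Negative.FrequencyLawReduction
import Literature.Analysis.FluidPDE.HardSphereTorusMeasure

/-!
# The horizon hypothesis `0 < τ` of `CollisionRate` is decoration

Negative knowledge for the crux `InformationPercolationEngine.CollisionRate` (stmt-AtomisticToContinuum-13481), from the
standing disprover's `Cruxes/CollisionRate/Disproof.lean` §1(b) (cycle 1).  The route decl asks its conclusion for every
horizon `τ` with `0 < τ`.  The statement obtained by replacing `0 < τ` with `τ ≤ 0` (everything else VERBATIM) is PROVED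
below: for `τ ≤ 0` the time window `Icc 0 τ` is contained in `{0}`, so
* the Enskog side `σ³ ∫_{s ∈ Icc 0 τ} e_s ds` is an integral over a Lebesgue-null set, hence `0`
  (`setIntegral_measure_zero`);
* the collision side is a `finsum` over the collision times in `Icc 0 τ ⊆ {0}`; on a good orbit `Φ_0 z = z`, so a
  collision at time `0` means that the INITIAL datum lies on a contact set `‖sepVec x_i x_j‖ = ε`, a codimension-one
  Lebesgue-null set (`volume_contactSet`), null for the local Gibbs law (`≪` Liouville `≪` Lebesgue).
Hence the deviation event is contained in `goodᶜ ∪ ⋃_{i ≠ j} contactSet i j`, a null set (`collisionRate_tauNonpos`).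
MORAL: the hypothesis `0 < τ` carries no content and cannot be mutated into a counterexample; degenerate horizons are
closed.  (With §1(a), `Negative/SwappedOrderTrivial.lean`: neither small `r` against `N` nor small `τ` can refute the
crux; every refutation must live at fixed `r`, positive macroscopic `τ`, `N → ∞`.)
refuter-cdisprove-stmt-AtomisticToContinuum-13481-0.
-/

noncomputable section

namespace Summit.AtomisticToContinuum.HydrodynamicLimit.Theorems.CollisionRate

open MeasureTheory Filter Set
open scoped ENNReal
open Literature.MathematicalPhysics.KineticTheory Literature.Analysis.FluidPDE

/-- The set of initial data with some pair in contact is Lebesgue-null (finite union of contact sets,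
`volume_contactSet`). [folklore] -/
theorem volume_setOf_exists_mem_contactSet {N : ℕ} {ε : ℝ} (hε : ε ≠ 0) :
    volume {z : Config (N + 1) (Fin 3) T3 |
      ∃ i j : Fin (N + 1), i ≠ j ∧ z ∈ contactSet (Torus.geometry (Fin 3)) (N + 1) ε i j} = 0 := by
  have hsub : {z : Config (N + 1) (Fin 3) T3 |
        ∃ i j : Fin (N + 1), i ≠ j ∧ z ∈ contactSet (Torus.geometry (Fin 3)) (N + 1) ε i j} ⊆
      ⋃ i : Fin (N + 1), ⋃ j : Fin (N + 1),
        (if i ≠ j then contactSet (Torus.geometry (Fin 3)) (N + 1) ε i j else ∅) := by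
    intro z hz
    rcases hz with ⟨i, j, hij, hz⟩
    simp only [Set.mem_iUnion]
    exact ⟨i, j, by simp [hij, hz]⟩
  refine measure_mono_null hsub ?_
  refine (measure_iUnion_null_iff).2 fun i => (measure_iUnion_null_iff).2 fun j => ?_
  split_ifs with hij
  · exact volume_contactSet hε hij
  · exact measure_empty

/-- The same set is null for every local Gibbs law (`localGibbsLaw = liouville.withDensity _`,
`liouville = volume.restrict _`). [folklore] -/
theorem localGibbsLaw_setOf_exists_mem_contactSet {σ : ℝ} (hσ : 0 < σ) {a₀ θ₀ : T3 → ℝ} {u₀ : T3 → V3} {N : ℕ}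
    (Φ : HardSphereFlow (Torus.geometry (Fin 3)) (hsDiameter σ N) (N + 1)) :
    localGibbsLaw σ a₀ u₀ θ₀ N Φ {z : Config (N + 1) (Fin 3) T3 |
      ∃ i j : Fin (N + 1), i ≠ j ∧ z ∈ contactSet (Torus.geometry (Fin 3)) (N + 1) (hsDiameter σ N) i j} = 0 := by
  unfold localGibbsLaw particleLaw
  refine withDensity_absolutelyContinuous _ _ ?_
  unfold liouville
  exact (Measure.absolutelyContinuous_of_le Measure.restrict_le_self)
    (volume_setOf_exists_mem_contactSet (hsDiameter_pos hσ N).ne')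

/-- **On a good orbit with no pair in contact at time `0`, the constant-mark statistic over a degenerate horizon
`τ ≤ 0` vanishes.** [folklore] -/
theorem evenStat_one_eq_zero_of_tau_nonpos {N : ℕ} {σ τ : ℝ} (hτ : τ ≤ 0)
    (Φ : HardSphereFlow (Torus.geometry (Fin 3)) (hsDiameter σ N) (N + 1)) (χ : ℝ × T3 → ℝ) (g : ℝ → ℝ) (r : ℝ)
    {z : Config (N + 1) (Fin 3) T3} (hz : z ∈ Φ.good)
    (hz0 : ¬ ∃ i j : Fin (N + 1), i ≠ j ∧ z ∈ contactSet (Torus.geometry (Fin 3)) (N + 1) (hsDiameter σ N) i j) :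
    evenStat σ N Φ τ χ g (fun _ => 1) r z = 0 := by
  -- the Enskog side: integral over a null window
  have hvol : (volume : Measure ℝ) (Set.Icc 0 τ) = 0 := by
    rw [Real.volume_Icc]
    exact ENNReal.ofReal_eq_zero.2 (by linarith)
  have hint : ∫ s in Set.Icc (0 : ℝ) τ, enskogRate σ N χ g (fun _ => 1) r s (Φ.flow s z) = 0 :=
    setIntegral_measure_zero _ hvol
  -- the collision side: no collision time in the window
  have hS : collisionTimes (Torus.geometry (Fin 3)) (hsDiameter σ N) (fun s => Φ.flow s z) ∩ Set.Icc 0 τ = ∅ := by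
    ext s
    simp only [Set.mem_inter_iff, Set.mem_Icc, Set.mem_empty_iff_false, iff_false, not_and]
    intro hs h0 hsτ
    have hs0 : s = 0 := le_antisymm (hsτ.trans hτ) h0
    subst hs0
    rcases hs with ⟨i, j, hij, hc⟩
    change Φ.flow 0 z ∈ _ at hc
    rw [Φ.flow_zero z hz] at hc
    exact hz0 ⟨i, j, hij, hc⟩
  rw [evenStat_def, hint, mul_zero, sub_zero]
  dsimp only [Literature.MathematicalPhysics.KineticTheory.collisionSum]
  rw [hS]
  simp

/-- **`CollisionRate` over degenerate horizons is true: the hypothesis `0 < τ` is decoration.**  The type below is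
VERBATIM the route decl `InformationPercolationEngine.CollisionRate` except that `∀ τ : ℝ, 0 < τ →` is replaced by
`∀ τ : ℝ, τ ≤ 0 →`.  Witnesses: `η₀ := 1`, `σ₀ := 1`, `r₀ := 1`, `N₀ := 0`; the deviation event lies in the null set
`goodᶜ ∪ {some pair in contact at time 0}`. [folklore] -/
theorem collisionRate_tauNonpos :
    ∃ η₀ : ℝ, 0 < η₀ ∧ ∀ (a₀ θ₀ : Literature.MathematicalPhysics.KineticTheory.T3 → ℝ) (u₀ : Literature.MathematicalPhysics.KineticTheory.T3 → Literature.MathematicalPhysics.KineticTheory.V3), Continuous a₀ → Continuous θ₀ → Continuous u₀ → (∀ x, 0 < a₀ x) → (∀ x, 0 < θ₀ x) → ∃ σ₀ : ℝ, 0 < σ₀ ∧ ∀ σ : ℝ, 0 < σ → σ < σ₀ → ∀ Φ : (N : ℕ) → Literature.Analysis.FluidPDE.HardSphereFlow (Literature.Analysis.FluidPDE.Torus.geometry (Fin 3)) (Literature.MathematicalPhysics.KineticTheory.hsDiameter σ N) (N + 1), ∀ τ : ℝ, τ ≤ 0 → ∀ χ : ℝ × Literature.MathematicalPhysics.KineticTheory.T3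 → ℝ, Continuous χ → ∀ g : ℝ → ℝ, Continuous g → (∀ a, η₀ ≤ a → g a = 0) → ∀ η δ : ℝ, 0 < η → 0 < δ → ∃ r₀ : ℝ, 0 < r₀ ∧ ∀ r : ℝ, 0 < r → r < r₀ → ∃ N₀ : ℕ, ∀ N : ℕ, N₀ ≤ N → let ε := Literature.MathematicalPhysics.KineticTheory.hsDiameter σ N; let G : Literature.Analysis.FluidPDE.Geometry (Fin 3) Literature.MathematicalPhysics.KineticTheory.T3 := Literature.Analysis.FluidPDE.Torus.geometry (Fin 3); let γ : Literature.Analysis.FluidPDE.Config (N + 1) (Fin 3) Literature.MathematicalPhysics.KineticTheory.T3 → ℝ → Literature.Analysis.FluidPDE.Config (N + 1) (Fin 3) Literature.MathematicalPhysics.KineticTheory.T3 := fun z s => (Φ N).flow s z; let bx : Literature.MathematicalPhysics.KineticTheory.T3 → Literature.MathematicalPhysics.KineticTheory.T3 → ℝ := fun x y => 3 / (Real.pi * r ^ 3) * max (1 - Literature.Analysis.FluidPDE.Torus.euclidDist x y / r) 0; let ρm : Literature.Analysis.FluidPDE.Config (N + 1) (Fin 3) Literature.MathematicalPhysics.KineticTheory.T3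 → ℝ → Literature.MathematicalPhysics.KineticTheory.T3 → ℝ := fun z s x₀ => ∫ q, bx q.1 x₀ ∂(Literature.Analysis.FluidPDE.empiricalMeasure (γ z s)); let B1 : Literature.Analysis.FluidPDE.Config (N + 1) (Fin 3) Literature.MathematicalPhysics.KineticTheory.T3 → ℝ → Literature.MathematicalPhysics.KineticTheory.T3 → ℝ := fun z s x₀ => ∫ p, bx p.1.1 x₀ * bx p.2.1 x₀ * (Real.pi * ‖p.1.2 - p.2.2‖) ∂((Literature.Analysis.FluidPDE.empiricalMeasure (γ z s)).prod (Literature.Analysis.FluidPDE.empiricalMeasure (γ z s))); let Kc : (Literature.Analysis.FluidPDE.Config (N + 1) (Fin 3) Literature.MathematicalPhysics.KineticTheory.T3 → ℝ → Fin (N + 1) → Fin (N + 1) → ℝ) → Literature.Analysis.FluidPDE.Config (N + 1) (Fin 3) Literature.MathematicalPhysics.KineticTheory.T3 → ℝ := fun F z => ε / (N + 1 : ℝ) * ∑ᶠ (s : ℝ) (_ : s ∈ Literature.Analysis.FluidPDE.collisionTimes G ε (γ z) ∩ Set.Icc 0 τ), ∑ i : Fin (N + 1), ∑ j : Fin (N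 + 1), (if i ≠ j ∧ ‖G.sepVec (γ z s i).1 (γ z s j).1‖ = ε then F z s i j else 0); let Y : ℝ → ℝ := fun a => 3 / (2 * Real.pi) * deriv Literature.MathematicalPhysics.KineticTheory.hsExcessFreeEnergy a; let D : Literature.Analysis.FluidPDE.Config (N + 1) (Fin 3) Literature.MathematicalPhysics.KineticTheory.T3 → ℝ := fun z => Kc (fun z s i _ => χ (s, (γ z s i).1) * g (σ ^ 3 * ρm z s (γ z s i).1)) z - σ ^ 3 * ∫ s in Set.Icc (0 : ℝ) τ, ∫ x : Literature.MathematicalPhysics.KineticTheory.T3, χ (s, x) * g (σ ^ 3 * ρm z s x) * Y (σ ^ 3 * ρm z s x) * B1 z s x; Literature.MathematicalPhysics.KineticTheory.localGibbsLaw σ a₀ u₀ θ₀ N (Φ N) {z | η < |D z|} ≤ ENNReal.ofReal δ := by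
  simp only [stat_eq_evenStat_one]
  refine ⟨1, one_pos, fun a₀ θ₀ u₀ _ _ _ _ _ => ⟨1, one_pos, ?_⟩⟩
  intro σ hσ _ Φ τ hτ χ _ g _ _ η δ hη _
  refine ⟨1, one_pos, fun r _ _ => ⟨0, fun N _ => ?_⟩⟩
  set B : Set (Config (N + 1) (Fin 3) T3) := {z | ∃ i j : Fin (N + 1), i ≠ j ∧
    z ∈ contactSet (Torus.geometry (Fin 3)) (N + 1) (hsDiameter σ N) i j} with hB
  have hzero : ∀ z ∈ (Φ N).good, z ∉ B → evenStat σ N (Φ N) τ χ g (fun _ => 1) r z = 0 := fun z hz hzB =>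
    evenStat_one_eq_zero_of_tau_nonpos hτ (Φ N) χ g r hz hzB
  calc localGibbsLaw σ a₀ u₀ θ₀ N (Φ N) {z | η < |evenStat σ N (Φ N) τ χ g (fun _ => 1) r z|}
      ≤ localGibbsLaw σ a₀ u₀ θ₀ N (Φ N) ((Φ N).goodᶜ ∪ B) := by
        refine measure_mono fun z hz' => ?_
        by_contra hzu
        simp only [Set.mem_union, Set.mem_compl_iff, not_or, not_not] at hzu
        have h0 := hzero z hzu.1 hzu.2
        simp only [Set.mem_setOf_eq] at hz'
        rw [h0, abs_zero] at hz'
        exact absurd hz' (not_lt.mpr hη.le)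
    _ ≤ localGibbsLaw σ a₀ u₀ θ₀ N (Φ N) (Φ N).goodᶜ + localGibbsLaw σ a₀ u₀ θ₀ N (Φ N) B :=
        measure_union_le _ _
    _ = 0 := by
        rw [EvenStressEnskog.localGibbsLaw_compl_good (Φ N), hB,
          localGibbsLaw_setOf_exists_mem_contactSet hσ (Φ N), add_zero]
    _ ≤ ENNReal.ofReal δ := zero_le

end Summit.AtomisticToContinuum.HydrodynamicLimit.Theorems.CollisionRate

end
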